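import Literature.NumberTheory.Rogawski1990.Ch12Sec1
import HarnessLib

/-!
# [Rogawski1990, §12.1 p. 172] Bridge note: the two readings of «`G`-equivalent» characters `θ` of `C = U(1)³` — «the SETS `{θ′ⱼ}`, `{θⱼ}` coincide»
# versus «`θ′ = θ ∘ w` for a permutation `w` of the indices» — compared on ★ `Ch13Sec1.CChar`: the permutation reading is strictly finer, and the two agree
# on regular `θ`

Topic `NumberTheory/Rogawski1990`; namespace `Literature.NumberTheory.Rogawski1990.Ch12Sec1Bridge` (squad TR bridge note; EDITION 2: the three theorems are stated
on `Set.range` and the permutation condition DIRECTLY, so that they do not depend on the body of ★ `Ch13Sec1.CChar.GEquiv` — which the squad's ERRATA row B5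
re-bodies from the set reading to the permutation reading — nor on ★ `Ch12Sec1.GEquivPerm`; EDITION 3 (after ★ `Ch13Sec1` EDITION 2 landed): §A added —
`gEquivPerm_iff` identifying ★ `Ch12Sec1.GEquivPerm` with the re-bodied ★ `Ch13Sec1.CChar.GEquiv`, `GEquiv` an equivalence relation, and the three
EDITION-2 theorems restated on `GEquiv`).  THEOREMS ONLY (kernel lane): no definition, no named fact, no `sorry`, no instance, no notation.
* `range_eq_of_exists_perm`: `θ′ = θ ∘ w` ⟹ `{θ′ⱼ} = {θⱼ}` (a permutation of the indices does not change the SET of values).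
* `range_eq_not_imp_exists_perm`: the converse fails — `θ′ = (0, 1, 1)`, `θ = (0, 0, 1)` in `Fin 2` have the same set of values but are not permutations of each
  other (the semi-regular shapes `(ψ, φψ, φψ)` ∕ `(ψ, ψ, φψ)` of [Rogawski1990, §12.1 p. 172]; this is why Prop. 13.1.2 (c), §13.1 p. 199, needs the permutation
  reading).
* `exists_perm_of_range_eq_of_isRegular`: on REGULAR characters («the `θⱼ` are distinct», ★ `Ch13Sec1.CChar.IsRegular`) the set reading already forces a permutation.
* §A (EDITION 3) [§12.1 p. 172, chunk p0163; §13.1 Prop. 13.1.2 (c) p. 199, chunk p0191]: after ERRATA row B5, ★ `Ch13Sec1.CChar.GEquiv θ θ′ :=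
  ∃ σ : Equiv.Perm (Fin 3), ∀ i, θ′ i = θ (σ i)` («the sets coincide» read with multiplicity) and ★ `Ch12Sec1.GEquivPerm θ′ θ := ∃ w : Equiv.Perm (Fin 3), θ′ = θ ∘ w`
  are the SAME relation up to `funext` and the order of the arguments: `gEquivPerm_iff`.  `GEquiv` is an equivalence relation (`gEquiv_refl ∕ _symm ∕ _trans`),
  implies the literal set reading (`range_eq_of_gEquiv`), is implied by it on regular characters (`gEquiv_of_isRegular_of_range_eq`) but not in general
  (`range_eq_not_imp_gEquiv`), and preserves regularity (`isRegular_iff_of_gEquiv`).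

## References
* [Rogawski1990] J. D. Rogawski, *Automorphic Representations of Unitary Groups in Three Variables*, Ann. of Math. Stud. 123 (1990), §12.1 p. 172 (chunk p0163),
  §13.1 Prop. 13.1.2 (c) p. 199 (chunk p0191).
-/

namespace Literature.NumberTheory.Rogawski1990.Ch12Sec1Bridge

open Literature.NumberTheory.Rogawski1990

variable {X : Type*}

/-- The permutation reading implies the set reading: `θ′ = θ ∘ w` gives `{θ′ⱼ} = {θⱼ}`. [cite: Rogawski1990, §12.1 (p. 172, chunk p0163)] -/
theorem range_eq_of_exists_perm {θ' θ : Ch13Sec1.CChar X} (h : ∃ w : Equiv.Perm (Fin 3), θ' = θ ∘ w) : Set.range θ' = Set.range θ := by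
  obtain ⟨w, rfl⟩ := h
  exact w.surjective.range_comp θ

/-- The converse fails: `(0, 1, 1)` and `(0, 0, 1)` have the same set of values `{0, 1}` but are not permutations of each other (different multiplicities) —
the semi-regular shapes `(ψ, φψ, φψ)` and `(ψ, ψ, φψ)`. [cite: Rogawski1990, §12.1 (p. 172, chunk p0163); §13.1 Prop. 13.1.2 (c) (p. 199, chunk p0191)] -/
theorem range_eq_not_imp_exists_perm :
    ∃ θ' θ : Ch13Sec1.CChar (Fin 2), Set.range θ' = Set.range θ ∧ ¬ ∃ w : Equiv.Perm (Fin 3), θ' = θ ∘ w := by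
  refine ⟨![0, 1, 1], ![0, 0, 1], ?_, ?_⟩
  · ext x
    simp only [Set.mem_range]
    constructor
    · rintro ⟨i, rfl⟩
      fin_cases i
      · exact ⟨0, rfl⟩
      · exact ⟨2, rfl⟩
      · exact ⟨2, rfl⟩
    · rintro ⟨i, rfl⟩
      fin_cases i
      · exact ⟨0, rfl⟩
      · exact ⟨0, rfl⟩
      · exact ⟨1, rfl⟩
  · rintro ⟨w, hw⟩
    -- the number of indices with value `1` differs: two for `θ′`, one for `θ`
    have h1 : (![0, 1, 1] : Fin 3 → Fin 2) 1 = 1 := rfl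
    have h2 : (![0, 1, 1] : Fin 3 → Fin 2) 2 = 1 := rfl
    rw [hw] at h1 h2
    simp only [Function.comp_apply] at h1 h2
    have hw1 : w 1 = 2 := by
      have := h1; revert this; generalize w 1 = k; fin_cases k <;> decide
    have hw2 : w 2 = 2 := by
      have := h2; revert this; generalize w 2 = k; fin_cases k <;> decide
    exact absurd (w.injective (hw1.trans hw2.symm)) (by decide)

/-- On regular characters the set reading already forces a permutation: if the `θ′ⱼ` are distinct and `{θ′ⱼ} = {θⱼ}`, then `θ′ = θ ∘ w` for a permutation `w`
of the indices (and the `θⱼ` are then distinct too). [cite: Rogawski1990, §12.1 (p. 172, chunk p0163)] -/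
theorem exists_perm_of_range_eq_of_isRegular {θ' θ : Ch13Sec1.CChar X} (hθ' : Ch13Sec1.CChar.IsRegular θ')
    (h : Set.range θ' = Set.range θ) : ∃ w : Equiv.Perm (Fin 3), θ' = θ ∘ w := by
  classical
  -- `θ′` is injective with the same range as `θ`; match each index of `θ′` with the index of `θ` carrying the same value
  have hmem : ∀ j : Fin 3, ∃ i : Fin 3, θ i = θ' j := fun j => by
    have : θ' j ∈ Set.range θ := by rw [← h]; exact ⟨j, rfl⟩
    exact this
  choose f hf using hmem
  have hfinj : Function.Injective f := fun j k hjk => hθ' (by rw [← hf j, ← hf k, hjk])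
  refine ⟨Equiv.ofBijective f (Finite.injective_iff_bijective.mp hfinj), ?_⟩
  funext j
  simp only [Function.comp_apply, Equiv.ofBijective_apply, hf]

/-! ## §A (EDITION 3) `G`-equivalence after ERRATA row B5: ★ `Ch12Sec1.GEquivPerm` = ★ `Ch13Sec1.CChar.GEquiv` (EDITION 2) -/

section GEquiv

/-- ★ `Ch12Sec1.GEquivPerm θ′ θ` («`θ′ = θ ∘ w`») and ★ `Ch13Sec1.CChar.GEquiv θ θ′` (EDITION 2, «`θ′ᵢ = θ_{σ i}`») are the same relation.
[cite: Rogawski1990, §12.1 (p. 172, chunk p0163)] -/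
theorem gEquivPerm_iff {θ' θ : Ch13Sec1.CChar X} : Ch12Sec1.GEquivPerm θ' θ ↔ Ch13Sec1.CChar.GEquiv θ θ' :=
  exists_congr fun _ => funext_iff

/-- `G`-equivalence is reflexive. [cite: Rogawski1990, §12.1 (p. 172, chunk p0163)] -/
theorem gEquiv_refl (θ : Ch13Sec1.CChar X) : Ch13Sec1.CChar.GEquiv θ θ :=
  ⟨1, fun _ => rfl⟩

/-- `G`-equivalence is symmetric. [cite: Rogawski1990, §12.1 (p. 172, chunk p0163)] -/
theorem gEquiv_symm {θ θ' : Ch13Sec1.CChar X} (h : Ch13Sec1.CChar.GEquiv θ θ') : Ch13Sec1.CChar.GEquiv θ' θ := by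
  obtain ⟨σ, hσ⟩ := h
  refine ⟨σ.symm, fun i => ?_⟩
  rw [hσ, Equiv.apply_symm_apply]

/-- `G`-equivalence is transitive. [cite: Rogawski1990, §12.1 (p. 172, chunk p0163)] -/
theorem gEquiv_trans {θ θ' θ'' : Ch13Sec1.CChar X} (h : Ch13Sec1.CChar.GEquiv θ θ') (h' : Ch13Sec1.CChar.GEquiv θ' θ'') : Ch13Sec1.CChar.GEquiv θ θ'' := by
  obtain ⟨σ, hσ⟩ := h
  obtain ⟨τ, hτ⟩ := h'
  exact ⟨τ.trans σ, fun i => by rw [hτ, hσ, Equiv.trans_apply]⟩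

/-- `G`-equivalence (with multiplicity) implies the print's literal set reading «the sets `{θ′ⱼ}`, `{θⱼ}` coincide».
[cite: Rogawski1990, §12.1 (p. 172, chunk p0163)] -/
theorem range_eq_of_gEquiv {θ θ' : Ch13Sec1.CChar X} (h : Ch13Sec1.CChar.GEquiv θ θ') : Set.range θ' = Set.range θ :=
  range_eq_of_exists_perm (gEquivPerm_iff.mpr h)

/-- The literal set reading does NOT imply `G`-equivalence: `(0, 0, 1)` and `(0, 1, 1)` (the semi-regular shapes `(ψ, ψ, φψ)`, `(ψ, φψ, φψ)`).
[cite: Rogawski1990, §12.1 (p. 172, chunk p0163); §13.1 Prop. 13.1.2 (c) (p. 199, chunk p0191)] -/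
theorem range_eq_not_imp_gEquiv : ∃ θ θ' : Ch13Sec1.CChar (Fin 2), Set.range θ' = Set.range θ ∧ ¬ Ch13Sec1.CChar.GEquiv θ θ' := by
  obtain ⟨θ', θ, h, hn⟩ := range_eq_not_imp_exists_perm
  exact ⟨θ, θ', h, fun hG => hn (gEquivPerm_iff.mpr hG)⟩

/-- On regular characters the literal set reading suffices: `θ′` regular and `{θ′ⱼ} = {θⱼ}` give `GEquiv θ θ′`.
[cite: Rogawski1990, §12.1 (p. 172, chunk p0163)] -/
theorem gEquiv_of_isRegular_of_range_eq {θ θ' : Ch13Sec1.CChar X} (hθ' : Ch13Sec1.CChar.IsRegular θ') (h : Set.range θ' = Set.range θ) :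
    Ch13Sec1.CChar.GEquiv θ θ' :=
  gEquivPerm_iff.mp (exists_perm_of_range_eq_of_isRegular hθ' h)

/-- `G`-equivalent characters are regular together («the `θⱼ` are distinct» is invariant under permuting the indices).
[cite: Rogawski1990, §12.1 (pp. 171–172, chunk p0163)] -/
theorem isRegular_iff_of_gEquiv {θ θ' : Ch13Sec1.CChar X} (h : Ch13Sec1.CChar.GEquiv θ θ') : Ch13Sec1.CChar.IsRegular θ ↔ Ch13Sec1.CChar.IsRegular θ' := by
  obtain ⟨σ, hσ⟩ := h
  have hθ' : θ' = θ ∘ σ := funext hσ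
  unfold Ch13Sec1.CChar.IsRegular
  rw [hθ']
  constructor
  · exact fun hθ => hθ.comp σ.injective
  · intro hθσ
    have : θ = (θ ∘ σ) ∘ σ.symm := by
      funext i
      simp only [Function.comp_apply, Equiv.apply_symm_apply]
    rw [this]
    exact hθσ.comp σ.symm.injective

end GEquiv

end Literature.NumberTheory.Rogawski1990.Ch12Sec1Bridge
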